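import Literature.NumberTheory.GaloisCohomology.Howard2004.TransverseIsotropyProofs
import Literature.NumberTheory.GaloisCohomology.Howard2004.RelaxedSelmerLagrangianCountProofs
import Literature.NumberTheory.GaloisCohomology.Howard2004.UnramifiedIsotropy
import Literature.NumberTheory.GaloisCohomology.Howard2004.InertLocalTauUnramifiedProofs
import HarnessLib

/-!
# Howard 2004, H.4 at an inert Kolyvagin prime: the induced local pairing `⟨x, a⟩_q = x ∪_e transport_q(a)` on
# `H¹(K_q, T)` is SYMMETRIC (proofs file)

Topic `NumberTheory/GaloisCohomology/Howard2004`. THEOREMS ONLY: no definition, no named fact, no instance, no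
notation, no `sorry`. Cell `pub/bsd-print-x9`, print leaf G87
`Literature.NumberTheory.GaloisCohomology.Howard2004.thm161_dvrKolyvaginBound` (Howard Thm. 1.6.1); seat
`bsd-line-x9-p1-w4` g16, brick (HSYMM); sequel to `TransverseIsotropyProofs`, `UnramifiedIsotropy`,
`RelaxedSelmerLagrangianCountProofs` (the map `T_q = transport_q ∘ (σ q = q ▸ ·)`).

SOURCE / WHY. B. Howard, *The Heegner point Kolyvagin system*, Compositio Math. **140** (2004) = arXiv:1202.6340,
§1.3 H.4 (p. 7 L69–82): «a perfect, symmetric, `R`-bilinear pairing `T × T → R(1)` … satisfies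
`(s^σ, t^{τστ⁻¹}) = (s, t)^σ` … Equivalently there is a `G_K`-invariant pairing `T × Tw(T) → R(1)` which is symmetric …
the induced local pairing `⟨ , ⟩_v : H¹(K_v, T) × H¹(K_v̄, T) → R`».  Lemma 1.5.7 (p. 10 L114–119): «For `x, y ∈ A` we
define the symbol `[x, y] = ⟨x_f, y_tr⟩`.  That `[x, y] = −[y, x]` follows immediately from `⟨x, y⟩ = 0` and the
isotropy of the finite and transverse submodules» — this step uses `⟨x_tr, y_f⟩_ℓ = ⟨y_f, x_tr⟩_ℓ`, the SYMMETRY of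
`⟨ , ⟩_ℓ` on `H¹(K_ℓ, T) × H¹(K_ℓ, T)` at an INERT prime `ℓ = ℓ̄`; it is the hypothesis `hsymm` of the tree's Lagrangian
algebra (`LagrangianSubmodulesDeltaTransfer.forall_pow_smul_eq_zero_of_lagrangian`).

WHAT IS PROVED.  At an inert finite place `q` (`hq : σ q = q`) where `Γ_{K_q}` acts trivially on `T` (`ℓ ∈ 𝓛_k`:
`Frob ≡ 1`), for the pairing `B(x, a) = x ∪_e T_q a`, `T_q a = transport_q(σ q = q ▸ a)`:
* §1 place-cast bookkeeping along `v = w` (`cast_oneCocycleClass`, `cast_cocycle_apply`, `cast_symm_cast_gal`,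
  `cast_mem_transverseCondition_iff`), and the transported class of a cocycle `z` at the inert `q` as the cocycle
  `k ↦ δ_q · z(φ'_q k)`, `φ'_q k = (σ q = q) ▸ φ_q k` (`transportH1_cast_oneCocycleClass`, `transportH1_cast_cocycle_apply`).
* §2 `ePairingLocal_toLin_apply`; `e_transport_values_add_eq_zero` (the cocycle identity
  `e(f g, δ_q t(φ'(gh)) − δ_q t(φ' g)) + e(t(gh) − t g, δ_q f(φ' g)) = −e(f g, δ_q t h) + e(f g, δ_q t h) = 0`); and
  **`DualityDatum.localCup_transportH1_cast_comm_of_unramified_of_transverse`** — `B(f, t) = B(t, f)` for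
  `f ∈ H¹_ur(K_q, T)`, `t ∈ H¹_tr(K_q, T)`, given: (φI) `φ'_q k ∈ I_q · k` (the transport fixes the unramified
  coordinate), (φΛ) `φ'_q k ∈ Λ_q · k⁻¹` with `Λ_q = Γ_{K_q} ∩ Γ_{K[ℓ]}` (it INVERTS the transverse coordinate — `K[ℓ]/ℚ` is
  generalised dihedral: a lift of complex conjugation conjugates `Gal(K[ℓ]_q/K_q)` by inversion), (δ)
  `e(u, δ_q w) = e(w, δ_q u)` (`ρ(δ_q)` is `e`-self-adjoint); by graded commutativity (`ContPairing.cupProduct_comm`)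
  the difference is the class of the cocycle of `e_transport_values_add_eq_zero`, which vanishes identically.
* §3 **`DualityDatum.localCup_transportH1_cast_comm`** = `hsymm`: `B(x, y) = B(y, x)` for ALL `x, y ∈ H¹(K_q, T)`,
  from §2, the decomposition `H¹ = H¹_ur + H¹_tr` (Prop. 1.1.9, hypothesis `hdecomp`; x9-p1-w3's
  `isCompl_unramifiedSubgroup_transverseCondition_of_cyclic`), and the isotropy of `H¹_ur` (`UnramifiedIsotropy`,
  transport respecting inertia) and of `H¹_tr` (`TransverseIsotropyProofs`, trivial action on `Tw T`, odd torsion).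

The local hypotheses (φI), (φΛ), (δ), `hdecomp`, the trivial actions and the torsion are the arithmetic of an inert
Kolyvagin prime for a chosen conjugation datum; they are NOT discharged here (x9-p1-w3's Prop 1.1.9 lane supplies the
group structure `Γ_{K_q} = ⋃ σ₀^j Λ_q`, total ramification, `H¹ = H¹_f ⊕ H¹_tr`).  `thm161_dvrKolyvaginBound` is NOT proved;
no summit statement is proved; the Birch–Swinnerton-Dyer conjecture is not proved by any of this.
References: [Howard2004HeegnerKolyvagin] §1.3 H.4, Lemma 1.5.7, Prop. 1.1.9, §1.2; [NeukirchSchmidtWingberg2008] I §4 (1.4.4);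
[SerreGaloisCohomology1997] I §2.3.
-/

set_option autoImplicit false

noncomputable section

open CategoryTheory Function NumberField IsDedekindDomain Field
open scoped NumberField

namespace Literature.NumberTheory.GaloisCohomology.Howard2004

open Literature.NumberTheory.GaloisRepresentations
open Literature.NumberTheory.GaloisRepresentations.DiscreteGaloisModule

variable {K : Type} [Field K] [NumberField K] {M : Type} [AddCommGroup M] [TopologicalSpace M]
  [DiscreteTopology M]

/-! ## §1 Place casts on cocycles, and the transported class at an inert prime -/

section Cast

variable (ρ : DiscreteGaloisModule K M)

/-- The place cast of the class of a cocycle is the class of the cast cocycle. [cite: Howard2004HeegnerKolyvagin, §1.3 (arXiv p. 7 L44–48, read at `λ̄ = λ`)] -/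
theorem cast_oneCocycleClass {v w : HeightOneSpectrum (𝓞 K)} (h : v = w)
    (z : contOneCocycles (ρ.toLocal (Sum.inr v)).toTopRep) :
    (h ▸ oneCocycleClass (ρ.toLocal (Sum.inr v)).toTopRep z : galoisCohomology (ρ.toLocal (Sum.inr w)) 1) =
      oneCocycleClass (ρ.toLocal (Sum.inr w)).toTopRep
        (h ▸ z : contOneCocycles (ρ.toLocal (Sum.inr w)).toTopRep) := by
  subst h
  rfl

/-- Values of a cast cocycle. [cite: Howard2004HeegnerKolyvagin, §1.3 (arXiv p. 7 L44–48, read at `λ̄ = λ`)] -/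
theorem cast_cocycle_apply {v w : HeightOneSpectrum (𝓞 K)} (h : v = w)
    (z : contOneCocycles (ρ.toLocal (Sum.inr v)).toTopRep) (g : absoluteGaloisGroup (w.adicCompletion K)) :
    (h ▸ z : contOneCocycles (ρ.toLocal (Sum.inr w)).toTopRep).1 g =
      z.1 (h.symm ▸ g : absoluteGaloisGroup (v.adicCompletion K)) := by
  subst h
  rfl

/-- Round trip of the casts on group elements. [cite: Howard2004HeegnerKolyvagin, §1.3 (arXiv p. 7 L44–48)] -/
theorem cast_symm_cast_gal {v w : HeightOneSpectrum (𝓞 K)} (h : v = w) (g : absoluteGaloisGroup (w.adicCompletion K)) :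
    (h ▸ (h.symm ▸ g : absoluteGaloisGroup (v.adicCompletion K)) : absoluteGaloisGroup (w.adicCompletion K)) = g := by
  subst h
  rfl

/-- The place cast preserves the transverse condition. [cite: Howard2004HeegnerKolyvagin, §1.2 and Def. 1.2.2 (arXiv p. 6)] -/
theorem cast_mem_transverseCondition_iff (p : ℕ) [Fact p.Prime] (ℓ : ℕ) (jbar : AlgebraicClosure K →+* ℂ)
    {v w : HeightOneSpectrum (𝓞 K)} (h : v = w) (x : galoisCohomology (ρ.toLocal (Sum.inr v)) 1) :
    (h ▸ x : galoisCohomology (ρ.toLocal (Sum.inr w)) 1) ∈ transverseCondition p ρ ℓ jbar w ↔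
      x ∈ transverseCondition p ρ ℓ jbar v := by
  subst h
  exact Iff.rfl

end Cast

namespace ConjugationDatum

/-- **The transported class at an inert prime, on cocycles**: for `hq : σ q = q` and a cocycle `z` of `T` on `Γ_{K_q}`,
`transport_q((σ q = q) ▸ [z])` is the class of `k ↦ δ_q · z(φ'_q k)`, `φ'_q k = (σ q = q) ▸ φ_q k`.
[cite: Howard2004HeegnerKolyvagin, §1.3 (arXiv p. 7 L44–48: «conjugation by `τ` induces `H¹(K_v̄, T) ≅ H¹(K_v, Tw T)`»)] -/
theorem transportH1_cast_oneCocycleClass (cd : ConjugationDatum K) (ρ : DiscreteGaloisModule K M)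
    {q : HeightOneSpectrum (𝓞 K)} (hq : cd.σ • q = q) (z : contOneCocycles (ρ.toLocal (Sum.inr q)).toTopRep) :
    cd.transportH1 ρ q (hq.symm ▸ oneCocycleClass (ρ.toLocal (Sum.inr q)).toTopRep z :
        galoisCohomology (ρ.toLocal (Sum.inr (cd.σ • q))) 1) =
      oneCocycleClass _ (contOneCocycles.pullback (cd.φ q) (cd.transportHom ρ q)
        (hq.symm ▸ z : contOneCocycles (ρ.toLocal (Sum.inr (cd.σ • q))).toTopRep)) := by
  rw [cast_oneCocycleClass ρ hq.symm z, transportH1_oneCocycleClass]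

/-- Values of the transported cocycle at an inert prime: `δ_q · z(φ'_q k)`. [cite: Howard2004HeegnerKolyvagin, §1.3 (arXiv p. 7 L44–48)] -/
theorem transportH1_cast_cocycle_apply (cd : ConjugationDatum K) (ρ : DiscreteGaloisModule K M)
    {q : HeightOneSpectrum (𝓞 K)} (hq : cd.σ • q = q) (z : contOneCocycles (ρ.toLocal (Sum.inr q)).toTopRep)
    (k : absoluteGaloisGroup (Place.Completion (Sum.inr q : Place K))) :
    (contOneCocycles.pullback (cd.φ q) (cd.transportHom ρ q)
        (hq.symm ▸ z : contOneCocycles (ρ.toLocal (Sum.inr (cd.σ • q))).toTopRep)).1 k =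
      ρ (cd.δ q) (z.1 (hq ▸ cd.φ q k : absoluteGaloisGroup (q.adicCompletion K))) := by
  rw [contOneCocycles.pullback_apply, transportHom_hom_apply]
  exact congrArg (ρ (cd.δ q)) (cast_cocycle_apply ρ hq.symm z (cd.φ q k))

end ConjugationDatum

/-! ## §2 `B(f, t) = B(t, f)` for `f` unramified and `t` transverse -/

namespace DualityDatum

variable {R : Type} [CommRing R] [Module R M] [TopologicalSpace R] [DiscreteTopology R]
  {p : ℕ} [Fact p.Prime] [Algebra ℤ_[p] R] {cd : ConjugationDatum K} {ρ : DiscreteGaloisModule K M}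

/-- The bilinear map underlying the local pairing of H.4 is `D.e`. [cite: Howard2004HeegnerKolyvagin, §1.3 H.4 (arXiv p. 7 L74–80)] -/
theorem ePairingLocal_toLin_apply (D : DualityDatum p cd ρ R) (v : Place K) (s t : M) :
    (D.ePairingLocal v).toLin s t = D.e s t := rfl

/-- **The cocycle identity behind `⟨f, t⟩_q = ⟨t, f⟩_q`** (values only, all on `Γ_{K_q}`): for continuous crossed
homomorphisms `f` killing `I_q` and `t` killing `Λ_q = Γ_{K_q} ∩ Γ_{K[ℓ]}` of the trivial module `T|_{K_q}`, under (φI), (φΛ), (δ):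
`e(f g, δ t(φ'(gh)) − δ t(φ' g)) + e(t(gh) − t g, δ f(φ' g)) = −e(f g, δ t h) + e(f g, δ t h) = 0`.
[cite: Howard2004HeegnerKolyvagin, §1.3 H.4 (arXiv p. 7 L69–82) and Lemma 1.5.7 (p. 10 L114–119)] -/
theorem e_transport_values_add_eq_zero (D : DualityDatum p cd ρ R) (ℓ : ℕ)
    (jbar : AlgebraicClosure K →+* ℂ) {q : HeightOneSpectrum (𝓞 K)} (hq : cd.σ • q = q)
    (htriv : ∀ (g : absoluteGaloisGroup (q.adicCompletion K)) (x : M), GaloisRep.toLocal q ρ g x = x)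
    (hφI : ∀ k : absoluteGaloisGroup (q.adicCompletion K), ∃ i ∈ absInertia (q.adicCompletion K),
      (hq ▸ cd.φ q k : absoluteGaloisGroup (q.adicCompletion K)) = i * k)
    (hφΛ : ∀ k : absoluteGaloisGroup (q.adicCompletion K), ∃ l ∈ localRingClassSubgroup ℓ jbar q,
      (hq ▸ cd.φ q k : absoluteGaloisGroup (q.adicCompletion K)) = l * k⁻¹)
    (hδ : ∀ u w : M, D.e u (ρ (cd.δ q) w) = D.e w (ρ (cd.δ q) u))
    (zf zt : contOneCocycles (GaloisRep.toLocal q ρ).toTopRep)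
    (hzf : ∀ τ ∈ absInertia (q.adicCompletion K), zf.1 τ = 0)
    (hzt : ∀ g ∈ localRingClassSubgroup ℓ jbar q, zt.1 g = 0) (g h : absoluteGaloisGroup (q.adicCompletion K)) :
    D.e (zf.1 g) (ρ (cd.δ q) (zt.1 (hq ▸ cd.φ q (g * h) : absoluteGaloisGroup (q.adicCompletion K))) -
        ρ (cd.δ q) (zt.1 (hq ▸ cd.φ q g : absoluteGaloisGroup (q.adicCompletion K)))) +
      D.e (zt.1 (g * h) - zt.1 g) (ρ (cd.δ q) (zf.1 (hq ▸ cd.φ q g : absoluteGaloisGroup (q.adicCompletion K)))) = 0 := by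
  -- (φΛ): `t(φ' k) = -t k`; (φI): `f(φ' k) = f k`
  have hZt : ∀ k : absoluteGaloisGroup (q.adicCompletion K),
      zt.1 (hq ▸ cd.φ q k : absoluteGaloisGroup (q.adicCompletion K)) = -zt.1 k := fun k => by
    obtain ⟨l, hl, hlk⟩ := hφΛ k
    rw [hlk, cocycle_apply_mul (GaloisRep.toLocal q ρ) htriv zt, hzt l hl, zero_add,
      cocycle_apply_inv (GaloisRep.toLocal q ρ) htriv zt]
  have hZf : ∀ k : absoluteGaloisGroup (q.adicCompletion K),
      zf.1 (hq ▸ cd.φ q k : absoluteGaloisGroup (q.adicCompletion K)) = zf.1 k := fun k => by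
    obtain ⟨i, hi, hik⟩ := hφI k
    rw [hik, cocycle_apply_mul (GaloisRep.toLocal q ρ) htriv zf, hzf i hi, zero_add]
  rw [hZt (g * h), hZt g, hZf g, cocycle_apply_mul (GaloisRep.toLocal q ρ) htriv zt g h, neg_add, map_add,
    add_sub_cancel_left, add_sub_cancel_left, map_neg, map_neg, hδ (zt.1 h) (zf.1 g), neg_add_cancel]

/-- **`⟨f, t⟩_q = ⟨t, f⟩_q` for `f ∈ H¹_ur(K_q, T)`, `t ∈ H¹_tr(K_q, T)` at an inert prime** with trivial local actions,
given (φI) `φ'_q k ∈ I_q k`, (φΛ) `φ'_q k ∈ Λ_q k^ℓ`, (δ) `e(u, δ_q w) = e(w, δ_q u)` and `(ℓ+1) · R = 0`: on cocycles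
`f ∪_e T_q t` is `(g,h) ↦ ℓ · e(f g, δ_q t h)` and `T_q f ∪' t` is `(g,h) ↦ e(t h, δ_q f g) = e(f g, δ_q t h)`, so
`[f ∪ T_q t] = −[T_q f ∪' t] = [t ∪ T_q f]` by graded commutativity.
[cite: Howard2004HeegnerKolyvagin, §1.3 H.4 (arXiv p. 7 L69–82: «symmetric») and Lemma 1.5.7 (p. 10 L114–119)] [cite: NeukirchSchmidtWingberg2008, I §4 (1.4.4)] -/
theorem localCup_transportH1_cast_comm_of_unramified_of_transverse (D : DualityDatum p cd ρ R) (ℓ : ℕ)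
    (jbar : AlgebraicClosure K →+* ℂ) {q : HeightOneSpectrum (𝓞 K)} (hq : cd.σ • q = q)
    (htriv : ∀ (g : absoluteGaloisGroup (q.adicCompletion K)) (x : M), GaloisRep.toLocal q ρ g x = x)
    (hp : ∀ x : M, ∃ n : ℕ, p ^ n • x = 0)
    (hφI : ∀ k : absoluteGaloisGroup (q.adicCompletion K), ∃ i ∈ absInertia (q.adicCompletion K),
      (hq ▸ cd.φ q k : absoluteGaloisGroup (q.adicCompletion K)) = i * k)
    (hφΛ : ∀ k : absoluteGaloisGroup (q.adicCompletion K), ∃ l ∈ localRingClassSubgroup ℓ jbar q,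
      (hq ▸ cd.φ q k : absoluteGaloisGroup (q.adicCompletion K)) = l * k⁻¹)
    (hδ : ∀ u w : M, D.e u (ρ (cd.δ q) w) = D.e w (ρ (cd.δ q) u))
    {f : galoisCohomology (ρ.toLocal (Sum.inr q)) 1} (hf : f ∈ unramifiedSubgroup (GaloisRep.toLocal q ρ) 1)
    {t : galoisCohomology (ρ.toLocal (Sum.inr q)) 1} (ht : t ∈ transverseCondition p ρ ℓ jbar q) :
    D.localCup (Sum.inr q) f (cd.transportH1 ρ q (hq.symm ▸ t : galoisCohomology (ρ.toLocal (Sum.inr (cd.σ • q))) 1)) =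
      D.localCup (Sum.inr q) t
        (cd.transportH1 ρ q (hq.symm ▸ f : galoisCohomology (ρ.toLocal (Sum.inr (cd.σ • q))) 1)) := by
  haveI : CompactSpace (absoluteGaloisGroup (Place.Completion (Sum.inr q : Place K))) :=
    absoluteGaloisGroup_compactSpace _
  obtain ⟨zf, rfl⟩ := oneCocycleClass_surjective _ f
  obtain ⟨zt, rfl⟩ := oneCocycleClass_surjective _ t
  have hzf := (mem_unramified_iff_forall_apply_eq_zero (GaloisRep.toLocal q ρ) htriv zf).1 hf
  have hzt := (oneCocycleClass_mem_transverseCondition_iff_forall_localRingClassSubgroup (p := p) ρ ℓ jbar q htriv hp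
    zt).1 ht
  rw [cd.transportH1_cast_oneCocycleClass ρ hq zt, cd.transportH1_cast_oneCocycleClass ρ hq zf]
  change (D.ePairingLocal (Sum.inr q)).cupProduct _ _ = (D.ePairingLocal (Sum.inr q)).cupProduct _ _
  refine ((D.ePairingLocal (Sum.inr q)).cupProduct_oneCocycleClass_eq_twoCocycleClass zf _).trans ?_
  refine Eq.trans ?_ ((D.ePairingLocal (Sum.inr q)).cupProduct_comm _ _).symm
  refine Eq.trans ?_ (congrArg Neg.neg
    ((D.ePairingLocal (Sum.inr q)).flip.cupProduct_oneCocycleClass_eq_twoCocycleClass _ zt)).symm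
  rw [eq_neg_iff_add_eq_zero, ← twoCocycleClass_add]
  -- the sum of the two cocycles vanishes identically
  refine Eq.trans ?_ (twoCocycleClass_zero ((D.twistOne.toLocal (Sum.inr q)).toTopRep))
  congr 1
  refine Subtype.ext (ContinuousMap.ext fun gh => ?_)
  obtain ⟨g, h⟩ := gh
  rw [Submodule.coe_add, ContinuousMap.add_apply, ContPairing.cupCocycle_apply, ContPairing.cupCocycle_apply,
    ContPairing.flip_toLin_apply]
  erw [cd.transportH1_cast_cocycle_apply ρ hq zt (g * h), cd.transportH1_cast_cocycle_apply ρ hq zt g,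
    cd.transportH1_cast_cocycle_apply ρ hq zf g]
  exact D.e_transport_values_add_eq_zero ℓ jbar hq htriv hφI hφΛ hδ zf zt hzf hzt g h

/-! ## §3 Symmetry on all of `H¹(K_q, T)` -/

/-- **`hsymm`: Howard's induced local pairing at an inert Kolyvagin prime is symmetric**, `B(x, y) = B(y, x)` with
`B(x, a) = x ∪_e transport_q((σ q = q) ▸ a)`, from §2, the decomposition `H¹(K_q, T) = H¹_ur + H¹_tr` (Prop. 1.1.9) and the
isotropy of the two pieces (`UnramifiedIsotropy`, `TransverseIsotropyProofs`).
[cite: Howard2004HeegnerKolyvagin, §1.3 H.4 (arXiv p. 7 L69–82: «symmetric») and Lemma 1.5.7 (p. 10 L114–119: «[x,y] = −[y,x] follows … from ⟨x,y⟩ = 0 and the isotropy of the finite and transverse submodules»)] [cite: NeukirchSchmidtWingberg2008, I §4 (1.4.4)] -/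
theorem localCup_transportH1_cast_comm (D : DualityDatum p cd ρ R) (hRp : IsPrimaryTorsion p R) (ℓ : ℕ)
    (jbar : AlgebraicClosure K →+* ℂ) {q : HeightOneSpectrum (𝓞 K)} (hq : cd.σ • q = q)
    (htriv : ∀ (g : absoluteGaloisGroup (q.adicCompletion K)) (x : M), GaloisRep.toLocal q ρ g x = x)
    (htriv' : ∀ (g : absoluteGaloisGroup ((cd.σ • q).adicCompletion K)) (x : M), GaloisRep.toLocal (cd.σ • q) ρ g x = x)
    (htrivTw : ∀ (g : absoluteGaloisGroup (q.adicCompletion K)) (x : M), GaloisRep.toLocal q (cd.twist ρ) g x = x)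
    (hp : ∀ x : M, ∃ n : ℕ, p ^ n • x = 0) {N : ℕ} (hN : Odd N) (hRN : ∀ r : R, N • r = 0)
    (hI : ∀ g ∈ absInertia (q.adicCompletion K), cd.φ q g ∈ absInertia ((cd.σ • q).adicCompletion K))
    (hφ : ∀ h ∈ localRingClassSubgroup ℓ jbar q, cd.φ q h ∈ localRingClassSubgroup ℓ jbar (cd.σ • q))
    (σ₀ : absoluteGaloisGroup (q.adicCompletion K))
    (hcyc : ∀ σ, ∃ j : ℕ, (σ₀ ^ j)⁻¹ * σ ∈ localRingClassSubgroup ℓ jbar q)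
    (hφI : ∀ k : absoluteGaloisGroup (q.adicCompletion K), ∃ i ∈ absInertia (q.adicCompletion K),
      (hq ▸ cd.φ q k : absoluteGaloisGroup (q.adicCompletion K)) = i * k)
    (hφΛ : ∀ k : absoluteGaloisGroup (q.adicCompletion K), ∃ l ∈ localRingClassSubgroup ℓ jbar q,
      (hq ▸ cd.φ q k : absoluteGaloisGroup (q.adicCompletion K)) = l * k⁻¹)
    (hδ : ∀ u w : M, D.e u (ρ (cd.δ q) w) = D.e w (ρ (cd.δ q) u))
    (hdecomp : ∀ x : galoisCohomology (ρ.toLocal (Sum.inr q)) 1,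
      ∃ f : galoisCohomology (ρ.toLocal (Sum.inr q)) 1, f ∈ unramifiedSubgroup (GaloisRep.toLocal q ρ) 1 ∧
        ∃ t : galoisCohomology (ρ.toLocal (Sum.inr q)) 1, t ∈ transverseCondition p ρ ℓ jbar q ∧ x = f + t)
    (x y : galoisCohomology (ρ.toLocal (Sum.inr q)) 1) :
    D.localCup (Sum.inr q) x (cd.transportH1 ρ q (hq.symm ▸ y : galoisCohomology (ρ.toLocal (Sum.inr (cd.σ • q))) 1)) =
      D.localCup (Sum.inr q) y
        (cd.transportH1 ρ q (hq.symm ▸ x : galoisCohomology (ρ.toLocal (Sum.inr (cd.σ • q))) 1)) := by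
  -- isotropy of the two pieces under `B`
  have hff : ∀ f ∈ unramifiedSubgroup (GaloisRep.toLocal q ρ) 1, ∀ f' ∈ unramifiedSubgroup (GaloisRep.toLocal q ρ) 1,
      D.localCup (Sum.inr q) f (cd.transportH1 ρ q
        (hq.symm ▸ f' : galoisCohomology (ρ.toLocal (Sum.inr (cd.σ • q))) 1)) = 0 := fun f hf f' hf' =>
    D.localCup_transportH1_eq_zero_of_mem_unramifiedSubgroup hRp q hI hf
      ((cast_mem_unramifiedSubgroup_iff ρ hq.symm f').2 hf')
  have htt : ∀ t ∈ transverseCondition p ρ ℓ jbar q, ∀ t' ∈ transverseCondition p ρ ℓ jbar q,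
      D.localCup (Sum.inr q) t (cd.transportH1 ρ q
        (hq.symm ▸ t' : galoisCohomology (ρ.toLocal (Sum.inr (cd.σ • q))) 1)) = 0 := fun t ht t' ht' =>
    D.localCup_transportH1_eq_zero_of_mem_transverseCondition ℓ jbar q htriv htriv'
      htrivTw hp hN hRN σ₀ hcyc hφ ht ((cast_mem_transverseCondition_iff ρ p ℓ jbar hq.symm t').2 ht')
  have hft : ∀ f ∈ unramifiedSubgroup (GaloisRep.toLocal q ρ) 1, ∀ t ∈ transverseCondition p ρ ℓ jbar q,
      D.localCup (Sum.inr q) f (cd.transportH1 ρ q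
          (hq.symm ▸ t : galoisCohomology (ρ.toLocal (Sum.inr (cd.σ • q))) 1)) =
        D.localCup (Sum.inr q) t (cd.transportH1 ρ q
          (hq.symm ▸ f : galoisCohomology (ρ.toLocal (Sum.inr (cd.σ • q))) 1)) := fun f hf t ht =>
    D.localCup_transportH1_cast_comm_of_unramified_of_transverse ℓ jbar hq htriv hp hφI hφΛ hδ hf ht
  -- biadditivity of `B`
  have hB : ∀ a b c d : galoisCohomology (ρ.toLocal (Sum.inr q)) 1,
      D.localCup (Sum.inr q) (a + b)
          (cd.transportH1 ρ q (hq.symm ▸ (c + d) : galoisCohomology (ρ.toLocal (Sum.inr (cd.σ • q))) 1)) =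
        D.localCup (Sum.inr q) a (cd.transportH1 ρ q (hq.symm ▸ c : galoisCohomology (ρ.toLocal (Sum.inr (cd.σ • q))) 1)) +
          D.localCup (Sum.inr q) a (cd.transportH1 ρ q (hq.symm ▸ d : galoisCohomology (ρ.toLocal (Sum.inr (cd.σ • q))) 1)) +
          (D.localCup (Sum.inr q) b
              (cd.transportH1 ρ q (hq.symm ▸ c : galoisCohomology (ρ.toLocal (Sum.inr (cd.σ • q))) 1)) +
            D.localCup (Sum.inr q) b
              (cd.transportH1 ρ q (hq.symm ▸ d : galoisCohomology (ρ.toLocal (Sum.inr (cd.σ • q))) 1))) :=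
    fun a b c d => by
      rw [cd.transportH1_cast_add ρ hq c d]
      simp only [map_add, AddMonoidHom.add_apply]
      exact add_add_add_comm _ _ _ _
  obtain ⟨f₁, hf₁, t₁, ht₁, rfl⟩ := hdecomp x
  obtain ⟨f₂, hf₂, t₂, ht₂, rfl⟩ := hdecomp y
  rw [hB f₁ t₁ f₂ t₂, hB f₂ t₂ f₁ t₁, hff f₁ hf₁ f₂ hf₂, hff f₂ hf₂ f₁ hf₁, htt t₁ ht₁ t₂ ht₂, htt t₂ ht₂ t₁ ht₁,
    hft f₁ hf₁ t₂ ht₂, ← hft f₂ hf₂ t₁ ht₁]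
  abel

end DualityDatum

end Literature.NumberTheory.GaloisCohomology.Howard2004

end
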